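import Summits.QuantumAdvantage.QuantumAdvantage.Theorems.CharDialMaskDialD
import Summits.QuantumAdvantage.QuantumAdvantage.Theorems.CharDialMaskDialE
import Summits.QuantumAdvantage.QuantumAdvantage.Theorems.CharDialNullDialB
import HarnessLib

/-!
# The mask dial, part F: the 3-PERIODIC RESIDUAL FAMILY `res2Y` — the FLIP CRITERION, robust escape from the null dial, capture by the mask dial (decomp-qadv lens-6 g18 REV3 «Res2», tree part 31H)

`res2Y p n` is the residual family `NullDial.resY` (part 31B) with the `(p−1)`-periodic tail pattern `ρ` replaced by the 3-periodic pattern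
`τ = (1, 2, −3)` (`tauZ`, cast into `𝔽_p`): cut `g` answers `[g ≡ F_g(u) (mod p)]`, `F_g` the form with coefficients `res2Coef p n (g/p)` =
`τ` on the sensitive coordinates (`i < p·(g/p)` or `i ≥ p·sepM`), `0` on the ignored ones.
(1) THE FLIP CRITERION ★ `res2_flip`: in ANY junta ⊕ linear-form presentation `D` of the STRATEGY `res2Y p n` (prime `p ≥ 7`), a set `W` that misses
the junta of the cut `g₁ = p·⌊n/p⌋` (`≡ 0 (mod p)`; canonical coefficients `τ` on every coordinate) and on which the PRESENTED form of `g₁` has zero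
sum is a zero-sum set of the CANONICAL pattern `τ` — flipping `W` from the all-zero input changes neither `g₁`'s junta bits nor its presented form
value, hence not its output, and canonically `g₁` accepts `u` iff `τ·u = 0`.
(2) ★ `res2_not_null`: since every window of length `ℓ ≢ 0 (mod 3)` has `τ`-sum in `{1, 2, −3, 3, −1, −2}` (`tau_window_ne_zero`) and among
`M ≥ 2^ℓ((log₂ n+1)²+1) > log₂ n` separated windows one misses the junta of `g₁` (`exists_blk_free`), NO `log₂ n`-junta presentation of `res2Y p n`
satisfies the (inlined) null-dial hypothesis of part 31A — a ROBUST (strategy-level) escape.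
(3) ★ `res2Data_mask`, ★★ `res2Y_hard`: the canonical junta-free presentation `res2Data` MEETS the (inlined) mask-dial hypothesis of part 31F with
the 4-sets `{9a, 9a+2, 9a+3, 9a+6}` in the tail (`τ`-values `1, −3, 1, 1`; `m = 4`, span `ℓ = 7`, mask = residues `{0,2,3,6} (mod 9)`), whence
`res2Y p n` is HARD for every modulus `p`, unconditionally (part 31F `maskDial_hard`; the annex's unused hypothesis `1 ≤ p` is dropped).
(4) ★ `res2_separation`: for every prime `p ≥ 7` and all large `n` the mask dial catches the canonical presentation of `res2Y p n` while NO
`log₂ n`-junta presentation of the same strategy meets the null dial — the mask dial is strictly larger than the null dial AT THE LEVEL OF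
STRATEGIES (part 31G gave the presentation-level separation).  In the annex this is half of `residual_class5_ssubset_class4` (the fifth residual
peel is strict) and of ★★ `residualHigh4_class_inhabited` (whose robust rank/sparse escapes are annex §37v machinery, not twinned here).
Supports item stmt-QuantumAdvantage-32604 (`CharDial.WalkHardFJLinOdd`); source: pub annex g18/OrbitDial38.lean REV3 (sha256 85dff9b064b3aef0…) §38j,
namespace `…Theses.OrbitDial` (`tauZ`, `tau`, `tau_window_ne_zero`, `res2Coef`, `res2Y`, `res2Data`, `res2_flip`, `exists_blk_free`,
`res2_not_nullHyp_robust`, `nineMask`, `zblk_nine_eq`, `res2Data_maskHyp`, `res2Y_hard`), statements verbatim with the dial hypotheses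
`NullHyp`/`MaskHyp` INLINED and the annex's `form` unfolded (Prop-free twin); `sepM` is part 31B's `NullDial.sepM`.
-/

set_option autoImplicit false

namespace Summit.QuantumAdvantage.AdviceFreeQNC0.JLinPeel.MaskDial

open Finset
open Summit.QuantumAdvantage.AdviceFreeQNC0
open Summit.QuantumAdvantage.AdviceFreeQNC0.JLinPeel.BlockDial
open Literature.Computability.MetaComplexity Literature.Computability.MetaComplexity.Smolensky

section Res2

variable {p n : ℕ}

/-! #### the pattern `τ = (1, 2, −3)` -/

/-- the 3-periodic zero-period-sum integer pattern `(1, 2, −3)`. -/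
def tauZ (i : ℕ) : ℤ := if i % 3 = 0 then 1 else if i % 3 = 1 then 2 else -3

/-- `τ`: the pattern `(1, 2, −3)` in `𝔽_p`. -/
def tau (p i : ℕ) : ZMod p := ((tauZ i : ℤ) : ZMod p)

/-- the value of `τ` at residue `0`. -/
theorem tau_of_mod0 {i : ℕ} (h : i % 3 = 0) : tau p i = 1 := by simp [tau, tauZ, h]

/-- the value of `τ` at residue `1`. -/
theorem tau_of_mod1 {i : ℕ} (h : i % 3 = 1) : tau p i = 2 := by simp [tau, tauZ, h]

/-- the value of `τ` at residue `2`. -/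
theorem tau_of_mod2 {i : ℕ} (h : i % 3 = 2) : tau p i = -3 := by simp [tau, tauZ, h]

/-- a non-zero integer of absolute value `≤ 6` is non-zero in `𝔽_p` (`p ≥ 7`). -/
theorem intCast_ne_zero (h7 : 7 ≤ p) {k : ℤ} (h0 : k ≠ 0) (hk : -6 ≤ k ∧ k ≤ 6) : ((k : ℤ) : ZMod p) ≠ 0 := by
  intro h
  have h' : ((k : ℤ) : ZMod p) = ((0 : ℤ) : ZMod p) := by rw [h, Int.cast_zero]
  rw [ZMod.intCast_eq_intCast_iff_dvd_sub] at h'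
  obtain ⟨c, hc⟩ := h'
  have hp : (7 : ℤ) ≤ (p : ℤ) := by exact_mod_cast h7
  rcases lt_trichotomy c 0 with hc0 | rfl | hc0
  · nlinarith
  · simp at hc; exact h0 (by omega)
  · nlinarith

/-- window sums of `τ` are 3-periodic in the length (a full period sums to zero). -/
theorem tauZ_range_add_three (S m : ℕ) : ∑ t ∈ range (m + 3), tauZ (S + t) = ∑ t ∈ range m, tauZ (S + t) := by
  rw [Finset.sum_range_succ, Finset.sum_range_succ, Finset.sum_range_succ]
  have h : tauZ (S + m) + tauZ (S + (m + 1)) + tauZ (S + (m + 2)) = 0 := by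
    unfold tauZ; split_ifs <;> omega
  linear_combination h

/-- ★ **no zero-sum window of length `≢ 0 (mod 3)`** for `τ` (`p ≥ 7`): the sum is one of `1, 2, −3, 3, −1, −2`. -/
theorem tau_window_ne_zero (h7 : 7 ≤ p) (S ℓ : ℕ) (hℓ : ℓ % 3 = 1 ∨ ℓ % 3 = 2) : ∑ t ∈ range ℓ, tau p (S + t) ≠ 0 := by
  have key : ∀ q r : ℕ, ∑ t ∈ range (3 * q + r), tauZ (S + t) = ∑ t ∈ range r, tauZ (S + t) := by
    intro q r
    induction q with
    | zero => simp
    | succ q ih => rw [show 3 * (q + 1) + r = (3 * q + r) + 3 by ring, tauZ_range_add_three, ih]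
  have hcast : ∑ t ∈ range ℓ, tau p (S + t) = ((∑ t ∈ range ℓ, tauZ (S + t) : ℤ) : ZMod p) := by
    unfold tau; push_cast; rfl
  rw [hcast, ← Nat.div_add_mod ℓ 3, key]
  rcases hℓ with h | h <;> rw [h]
  · rw [Finset.sum_range_one]
    exact intCast_ne_zero h7 (by unfold tauZ; split_ifs <;> omega) (by unfold tauZ; split_ifs <;> omega)
  · rw [Finset.sum_range_succ, Finset.sum_range_one]
    exact intCast_ne_zero h7 (by unfold tauZ; split_ifs <;> omega) (by unfold tauZ; split_ifs <;> omega)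

/-- the `τ`-sum over a window `[S k, S k + ℓ)` of coordinates is the window sum of the pattern. -/
theorem tau_blk_sum {M ℓ : ℕ} (S : Fin M → ℕ) (k : Fin M) (hfit : S k + ℓ ≤ n) :
    ∑ i ∈ blk (n := n) ℓ S k, tau p i.val = ∑ t ∈ range ℓ, tau p (S k + t) := by
  rw [vdm_blk_eq_image S k hfit, Finset.sum_image, ← Fin.sum_univ_eq_sum_range]
  · intro t _ t' _ h
    have := Fin.ext_iff.mp h
    exact Fin.ext (by simpa using this)

/-! #### the family `res2Y` and its canonical presentation -/

/-- coefficient vector with block-prefix parameter `q`: `τ` on the sensitive coordinates, `0` on the ignored ones. -/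
def res2Coef (p n q : ℕ) : Fin n → ZMod p := fun i =>
  if i.val < p * NullDial.sepM p n then (if i.val < p * q then tau p i.val else 0) else tau p i.val

/-- **the 3-periodic residual family**: cut `g` outputs `[g ≡ F_g(u) (mod p)]`, `F_g` the form of `res2Coef p n (g / p)` (the annex's `form` unfolded). -/
def res2Y (p n : ℕ) : Fin (n + 1) → (Fin n → Bool) → Bool :=
  fun g u => decide ((((g : ℕ) : ZMod p)) = ∑ i, if u i then res2Coef p n (g.val / p) i else 0)

/-- its canonical junta-free presentation. -/
def res2Data (p n : ℕ) : JLinPeel.JLinData p n where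
  J := fun _ => ∅
  a := fun g => res2Coef p n (g.val / p)
  h := fun g _ s => decide ((((g : ℕ) : ZMod p)) = s)
  hJ := fun _ _ _ _ _ => rfl

/-- the presentation presents `res2Y`. -/
theorem res2Data_strat (p n : ℕ) : (res2Data p n).strat = res2Y p n := rfl

/-- its juntas are empty. -/
theorem res2Data_J (p n : ℕ) (g : Fin (n + 1)) : (res2Data p n).J g = ∅ := rfl

/-- on tail coordinates the canonical coefficient is `τ`, whatever the prefix parameter. -/
theorem res2Coef_tail (q : ℕ) (i : Fin n) (hi : p * NullDial.sepM p n ≤ i.val) : res2Coef p n q i = tau p i.val := by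
  unfold res2Coef
  rw [if_neg (by omega)]

/-- the cut `p·⌊n/p⌋` has canonical coefficients `τ` everywhere. -/
theorem res2Coef_last (i : Fin n) : res2Coef p n (n / p) i = tau p i.val := by
  have hMn : p * NullDial.sepM p n ≤ p * (n / p) :=
    Nat.mul_le_mul_left p (Nat.div_le_div_right (Nat.div_le_self n 3))
  unfold res2Coef
  by_cases hz : i.val < p * NullDial.sepM p n
  · rw [if_pos hz, if_pos (lt_of_lt_of_le hz hMn)]
  · rw [if_neg hz]

/-! #### (1) the FLIP CRITERION -/

/-- a form evaluated at an indicator input is the coefficient sum over the set. -/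
theorem ite_mem_sum (a : Fin n → ZMod p) (W : Finset (Fin n)) :
    (∑ i, if decide (i ∈ W) then a i else 0) = ∑ i ∈ W, a i := by
  simp only [decide_eq_true_eq]
  rw [Finset.sum_ite_mem, Finset.univ_inter]

/-- the presented form of an indicator input is the coefficient sum over the set. -/
theorem jform_indicator (D : JLinPeel.JLinData p n) (g : Fin (n + 1)) (W : Finset (Fin n)) :
    D.form g (fun i => decide (i ∈ W)) = ∑ i ∈ W, D.a g i := by
  unfold JLinPeel.JLinData.form
  exact ite_mem_sum (D.a g) W

/-- ★ **THE FLIP CRITERION**: in ANY presentation `D` of `res2Y` (`p ≥ 7` prime), a set `W` missing the junta of the cut `g₁ = p·⌊n/p⌋` with zero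
PRESENTED form-sum on `W` has zero CANONICAL `τ`-sum. -/
theorem res2_flip [hp : Fact p.Prime] (D : JLinPeel.JLinData p n) (hD : D.strat = res2Y p n)
    (W : Finset (Fin n)) (hWJ : ∀ i ∈ W, i ∉ D.J ⟨p * (n / p), Nat.lt_succ_of_le (Nat.mul_div_le n p)⟩)
    (hsum : ∑ i ∈ W, D.a ⟨p * (n / p), Nat.lt_succ_of_le (Nat.mul_div_le n p)⟩ i = 0) :
    ∑ i ∈ W, tau p i.val = 0 := by
  classical
  have hp0 : 0 < p := hp.out.pos
  set g₁ : Fin (n + 1) := ⟨p * (n / p), Nat.lt_succ_of_le (Nat.mul_div_le n p)⟩ with hg₁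
  have hg₁0 : (((g₁ : ℕ) : ZMod p)) = 0 := by
    show (((p * (n / p) : ℕ)) : ZMod p) = 0
    rw [Nat.cast_mul, ZMod.natCast_self, zero_mul]
  have hq : g₁.val / p = n / p := by show p * (n / p) / p = n / p; exact Nat.mul_div_cancel_left _ hp0
  set u0 : Fin n → Bool := fun _ => false with hu0
  set u1 : Fin n → Bool := fun i => decide (i ∈ W) with hu1
  have hform0 : D.form g₁ u0 = 0 := by simp [JLinPeel.JLinData.form, u0]
  have hform1 : D.form g₁ u1 = 0 := by rw [hu1, jform_indicator, hsum]
  have hagree : ∀ i ∈ D.J g₁, u0 i = u1 i := by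
    intro i hi
    have : i ∉ W := fun hW => hWJ i hW hi
    simp [u0, u1, this]
  have hpres : D.strat g₁ u0 = D.strat g₁ u1 := by
    show D.h g₁ u0 (D.form g₁ u0) = D.h g₁ u1 (D.form g₁ u1)
    rw [hform0, hform1, D.hJ g₁ u0 u1 hagree]
  rw [hD] at hpres
  have hc0 : res2Y p n g₁ u0 = true := by
    unfold res2Y
    rw [decide_eq_true_eq, hg₁0]
    simp [u0]
  have hc1 : res2Y p n g₁ u1 = decide ((0 : ZMod p) = ∑ i ∈ W, tau p i.val) := by
    unfold res2Y
    rw [hg₁0, hq, hu1, ite_mem_sum]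
    congr 1
    rw [Finset.sum_congr rfl fun i _ => res2Coef_last i]
  rw [hc0, hc1] at hpres
  exact (decide_eq_true_eq.mp hpres.symm).symm

/-! #### (2) ROBUST escape from the null dial -/

/-- one of `M > |J|` separated windows misses `J`. -/
theorem exists_blk_free {M ℓ : ℕ} {S : Fin M → ℕ} (hS : (∀ k k' : Fin M, k < k' → S k + ℓ ≤ S k') ∧ (∀ k : Fin M, S k + ℓ ≤ n))
    (J : Finset (Fin n)) (hM : J.card < M) : ∃ k : Fin M, ∀ i ∈ blk (n := n) ℓ S k, i ∉ J := by
  classical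
  by_contra h
  push Not at h
  choose f hf hfJ using h
  have hinj : Function.Injective f := by
    intro k k' hkk
    have hk := hf k
    have hk' := hf k'
    rw [hkk] at hk
    rw [mem_blk] at hk hk'
    by_contra hne
    rcases lt_or_gt_of_ne hne with hlt | hlt
    · have := hS.1 k k' hlt; omega
    · have := hS.1 k' k hlt; omega
  have hcard : (univ.image f).card = M := by rw [card_image_of_injective _ hinj, card_univ, Fintype.card_fin]
  have hsub : univ.image f ⊆ J := by
    intro i hi
    obtain ⟨k, -, rfl⟩ := mem_image.1 hi
    exact hfJ k
  have := card_le_card hsub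
  omega

/-- ★ **ROBUST NULL ESCAPE**: no `log₂ n`-junta presentation of the strategy `res2Y p n` (`p ≥ 7` prime) satisfies the (inlined) null-dial
hypothesis of part 31A (any `n`). -/
theorem res2_not_null [hp : Fact p.Prime] (h7 : 7 ≤ p) (D : JLinPeel.JLinData p n) (hD : D.strat = res2Y p n)
    (hJ : ∀ g, (D.J g).card ≤ Nat.log 2 n) :
    ¬ (∃ (ℓ M : ℕ) (S : Fin M → ℕ), (ℓ % 3 = 1 ∨ ℓ % 3 = 2) ∧
        ((∀ k k' : Fin M, k < k' → S k + ℓ ≤ S k') ∧ (∀ k : Fin M, S k + ℓ ≤ n)) ∧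
        2 ^ ℓ * ((Nat.log 2 n + 1) * (Nat.log 2 n + 1) + 1) ≤ M ∧
          ∀ g (k : Fin M), ∑ i ∈ blk ℓ S k, D.a g i = 0) := by
  rintro ⟨ℓ, M, S, hℓ3, hS, hM, hnull⟩
  set g₁ : Fin (n + 1) := ⟨p * (n / p), Nat.lt_succ_of_le (Nat.mul_div_le n p)⟩ with hg₁
  have h2 : 1 ≤ 2 ^ ℓ := Nat.one_le_two_pow
  have hML : (D.J g₁).card < M := by
    have := hJ g₁
    have h1 : (Nat.log 2 n + 1) * (Nat.log 2 n + 1) + 1 ≤ M := le_trans (Nat.le_mul_of_pos_left _ h2) hM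
    nlinarith
  obtain ⟨k, hk⟩ := exists_blk_free hS (D.J g₁) hML
  have hflip := res2_flip D hD _ hk (hnull g₁ k)
  rw [tau_blk_sum S k (hS.2 k)] at hflip
  exact tau_window_ne_zero h7 (S k) ℓ hℓ3 hflip

/-! #### (3) the canonical presentation MEETS the mask dial -/

/-- the mask: residues `0, 2, 3, 6 (mod 9)`. -/
def nineMask (n : ℕ) : Finset (Fin n) := univ.filter fun i : Fin n => i.val % 9 = 0 ∨ i.val % 9 = 2 ∨ i.val % 9 = 3 ∨ i.val % 9 = 6

/-- the masked block of the span `[9a, 9a+7)` is `{9a, 9a+2, 9a+3, 9a+6}`. -/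
theorem zblk_nine_eq {M : ℕ} (q₀ : ℕ) (k : Fin M) (h : 9 * (q₀ + k.val) + 7 ≤ n) :
    zblk (n := n) 7 (fun k : Fin M => 9 * (q₀ + k.val)) (nineMask n) k =
      {(⟨9 * (q₀ + k.val), by omega⟩ : Fin n), ⟨9 * (q₀ + k.val) + 2, by omega⟩, ⟨9 * (q₀ + k.val) + 3, by omega⟩,
        ⟨9 * (q₀ + k.val) + 6, by omega⟩} := by
  ext i
  rw [zblk, mem_filter, mem_blk, nineMask, mem_filter, mem_insert, mem_insert, mem_insert, mem_singleton, Fin.ext_iff, Fin.ext_iff,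
    Fin.ext_iff, Fin.ext_iff]
  simp only [mem_univ, true_and]
  omega

/-- ★ **the canonical presentation of `res2Y` meets the MASK dial** (inlined `MaskHyp`; all large `n`; every modulus `p`, the annex's unused hypothesis `1 ≤ p` dropped): span `ℓ = 7`, spans at
`9a` in the tail, mask `nineMask`, masked blocks of size `m = 4`. -/
theorem res2Data_mask (p : ℕ) : ∃ n₁ : ℕ, ∀ n ≥ n₁,
    ∃ (ℓ m M : ℕ) (S : Fin M → ℕ) (Z : Finset (Fin n)), (m % 3 = 1 ∨ m % 3 = 2) ∧
      ((∀ k k' : Fin M, k < k' → S k + ℓ ≤ S k') ∧ (∀ k : Fin M, S k + ℓ ≤ n)) ∧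
      (∀ k : Fin M, (zblk ℓ S Z k).card = m) ∧
      2 ^ m * ((Nat.log 2 n + 1) * (Nat.log 2 n + 1) + 1) ≤ M ∧
        ∀ g (k : Fin M), ∑ i ∈ zblk ℓ S Z k, (res2Data p n).a g i = 0 := by
  obtain ⟨m₀, hm₀⟩ := DWalk.const_mul_logPow_le' 1200 2
  refine ⟨max m₀ 4, fun n hn => ?_⟩
  have hn₀ : m₀ ≤ n := le_trans (le_max_left _ _) hn
  have hn4 : 4 ≤ n := le_trans (le_max_right _ _) hn
  have hlog := hm₀ n hn₀
  have hL1 : 1 ≤ Nat.log 2 n := Nat.log_pos (by norm_num) (by omega)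
  set L : ℕ := Nat.log 2 n with hL
  set M : ℕ := 2 ^ 4 * ((L + 1) * (L + 1) + 1) with hM
  set q₀ : ℕ := p * NullDial.sepM p n / 9 + 1 with hq₀
  have hsep3 := NullDial.p_mul_sepM_le p n
  have hq₀m : p * NullDial.sepM p n < 9 * q₀ := by
    have h1 := Nat.lt_div_mul_add (a := p * NullDial.sepM p n) (b := 9) (by norm_num)
    rw [hq₀]; omega
  have hq₀le : 9 * q₀ ≤ n / 3 + 9 := by
    have h1 := Nat.div_mul_le_self (p * NullDial.sepM p n) 9
    rw [hq₀]; omega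
  have hbudget : 9 * q₀ + 9 * M ≤ n := by
    have h5 : (L + 1) * (L + 1) + 1 ≤ 5 * L ^ 2 := by nlinarith [hL1]
    have hM5 : M ≤ 80 * L ^ 2 := by rw [hM]; omega
    have h3 : 3 * (n / 3) ≤ n := Nat.mul_div_le n 3
    have h4 : L ^ 2 ≥ 1 := by nlinarith [hL1]
    omega
  have hfit : ∀ k : Fin M, 9 * (q₀ + k.val) + 7 ≤ n := by
    intro k
    have hk : k.val + 1 ≤ M := k.isLt
    nlinarith
  have hsep : ∀ k k' : Fin M, k < k' → 9 * (q₀ + k.val) + 7 ≤ 9 * (q₀ + k'.val) := by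
    intro k k' hkk
    have : k.val + 1 ≤ k'.val := hkk
    omega
  have htailS : ∀ k : Fin M, p * NullDial.sepM p n ≤ 9 * (q₀ + k.val) := by
    intro k; nlinarith
  refine ⟨7, 4, M, fun k => 9 * (q₀ + k.val), nineMask n, Or.inl rfl, ⟨hsep, hfit⟩, fun k => ?_, le_of_eq hM.symm, fun g k => ?_⟩
  · rw [zblk_nine_eq q₀ k (hfit k), card_insert_of_notMem, card_insert_of_notMem, card_insert_of_notMem, card_singleton]
    all_goals simp [Fin.ext_iff]
  · rw [zblk_nine_eq q₀ k (hfit k), sum_insert, sum_insert, sum_insert, sum_singleton]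
    · show res2Coef p n (g.val / p) _ + (res2Coef p n (g.val / p) _ + (res2Coef p n (g.val / p) _ + res2Coef p n (g.val / p) _)) = 0
      have ht := htailS k
      rw [res2Coef_tail _ _ (by simp only; omega), res2Coef_tail _ _ (by simp only; omega), res2Coef_tail _ _ (by simp only; omega),
        res2Coef_tail _ _ (by simp only; omega)]
      simp only
      rw [tau_of_mod0 (by omega : 9 * (q₀ + k.val) % 3 = 0), tau_of_mod2 (by omega : (9 * (q₀ + k.val) + 2) % 3 = 2),
        tau_of_mod0 (by omega : (9 * (q₀ + k.val) + 3) % 3 = 0), tau_of_mod0 (by omega : (9 * (q₀ + k.val) + 6) % 3 = 0)]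
      ring
    all_goals simp [Fin.ext_iff]

/-- ★★ **`res2Y` IS HARD — unconditionally**, for every modulus `p` (annex: `1 ≤ p`, unused): `∃ θ < 1, ∃ n₀, ∀ n ≥ n₀, ∀ c, #{u : res2Y wins the mod-3 walk game} ≤ θ·2ⁿ`
(part 31F `maskDial_hard` on the canonical presentation). -/
theorem res2Y_hard (p : ℕ) :
    ∃ θ : ℝ, θ < 1 ∧ ∃ n₀ : ℕ, ∀ n ≥ n₀, ∀ c : ℕ,
      ((Finset.univ.filter fun u : Fin n → Bool => ringWinU c (res2Y p n) u = true).card : ℝ) ≤ θ * (2 : ℝ) ^ n := by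
  obtain ⟨θ, hθ, N₁, hdial⟩ := maskDial_hard
  obtain ⟨n₁, hn₁⟩ := res2Data_mask p
  refine ⟨θ, hθ, max n₁ (2 ^ N₁), fun n hn c => ?_⟩
  have hn1 : n₁ ≤ n := le_trans (le_max_left _ _) hn
  have hnN : 2 ^ N₁ ≤ n := le_trans (le_max_right _ _) hn
  have hLN : N₁ ≤ Nat.log 2 n := (Nat.le_log_iff_pow_le (by norm_num) (by have := Nat.one_le_two_pow (n := N₁); omega)).2 hnN
  obtain ⟨ℓ, m, M, S, Z, hm3, hS, hm, hM, hzero⟩ := hn₁ n hn1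
  have hMN : 2 ^ m * (N₁ + 1) ≤ M := by
    refine le_trans (Nat.mul_le_mul_left _ ?_) hM
    nlinarith
  rw [← res2Data_strat p n]
  exact hdial ℓ m hm3 p n M (Nat.log 2 n) S Z hS hm hMN hM c (res2Data p n) (fun g => by rw [res2Data_J]; simp) hzero

/-! #### (4) the STRATEGY-LEVEL separation of the mask dial from the null dial -/

/-- ★ **THE MASK DIAL IS STRICTLY LARGER THAN THE NULL DIAL AT THE LEVEL OF STRATEGIES.**  For every prime `p ≥ 7` and all large `n`: the canonical
presentation of `res2Y p n` has juntas `≤ log₂ n` (empty) and satisfies the (inlined) mask-dial hypothesis, while NO `log₂ n`-junta presentation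
of the strategy `res2Y p n` satisfies the (inlined) null-dial hypothesis. -/
theorem res2_separation (p : ℕ) [hp : Fact p.Prime] (hp7 : 7 ≤ p) :
    ∃ n₁ : ℕ, ∀ n ≥ n₁,
      (∀ g, ((res2Data p n).J g).card ≤ Nat.log 2 n) ∧
      (∃ (ℓ m M : ℕ) (S : Fin M → ℕ) (Z : Finset (Fin n)), (m % 3 = 1 ∨ m % 3 = 2) ∧
        ((∀ k k' : Fin M, k < k' → S k + ℓ ≤ S k') ∧ (∀ k : Fin M, S k + ℓ ≤ n)) ∧
        (∀ k : Fin M, (zblk ℓ S Z k).card = m) ∧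
        2 ^ m * ((Nat.log 2 n + 1) * (Nat.log 2 n + 1) + 1) ≤ M ∧
          ∀ g (k : Fin M), ∑ i ∈ zblk ℓ S Z k, (res2Data p n).a g i = 0) ∧
      ∀ D : JLinPeel.JLinData p n, D.strat = res2Y p n → (∀ g, (D.J g).card ≤ Nat.log 2 n) →
        ¬ (∃ (ℓ M : ℕ) (S : Fin M → ℕ), (ℓ % 3 = 1 ∨ ℓ % 3 = 2) ∧
            ((∀ k k' : Fin M, k < k' → S k + ℓ ≤ S k') ∧ (∀ k : Fin M, S k + ℓ ≤ n)) ∧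
            2 ^ ℓ * ((Nat.log 2 n + 1) * (Nat.log 2 n + 1) + 1) ≤ M ∧
              ∀ g (k : Fin M), ∑ i ∈ blk ℓ S k, D.a g i = 0) := by
  obtain ⟨n₁, hn₁⟩ := res2Data_mask p
  exact ⟨n₁, fun n hn => ⟨fun g => by rw [res2Data_J]; simp, hn₁ n hn, fun D hD hJ => res2_not_null hp7 D hD hJ⟩⟩

end Res2

end Summit.QuantumAdvantage.AdviceFreeQNC0.JLinPeel.MaskDial
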